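import Summits.QuantumFields.YangMills.Theorems.BalabanUVNodesN18CombStepAxialGauge
import Summits.QuantumFields.BalabanUV.T4Continuum.Spine.NE7.QLaBlockAvgLinear
import Literature.MathematicalPhysics.QuantumFieldTheory.Balaban1983to89.B12B0LoopGeometry267
import Literature.MathematicalPhysics.QuantumFieldTheory.Balaban1983to89.B7TransferAnalyticMean
import HarnessLib

/-!
# Route `UnitScaleTilt`, crux «MinimiserStabilityRegPr» (stmt-QuantumFields-19200, stub EX), route (α), node N06(d = 3) — (N) «`Q_k(U₀)` onto», STEP 1:
# **THE COVARIANT BLOCK Ad-MEAN RECURSION IS ONTO, LEVEL BY LEVEL, BY CENTRE-SUPPORTED SEEDS** ([Balaban1985BackgroundPropagators] (3.18)–(3.19) p. 393 «Q′ onto»)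

Cell `ym3-torus` (HUMAN RULING D-0037, YM ladder rung R3 — YM₃ on T³, NOT d = 4, NOT Clay; YM gap NOT proved), width seat `ym3-torus-px16` (gen 2; LOCATE `LOCATE-QK-ONTO-px16g2.md` §2,
19200 evidence #48).  THEOREMS ONLY (0 `def`, 0 `sorry`); `--supports stmt-QuantumFields-19200 --as helper`; count-neutral; pure lattice bookkeeping, generic `P : Params` and normed
`ℂ`-algebra `𝔸`; NO claim on the crux, the stub, d = 4 or the gap.

THE PRINT.  [Balaban1985BackgroundPropagators] p. 393: *«Q′_j(U) … linear parts of the averaging operations for gauge transformations … (3.18) … Q′ onto (3.19)»*; [Balaban1985Averaging] (11)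
p. 19 (the block average of a gauge transformation: the Ad-mean over the block of the values transported to the centre along the contours `Γ_{y,x}`).  In the tree the recursion is the
`hsucc` of ✓`Prop7SymAvgTwSGaugeDir.QTwS_gaugeDir_of_avgSeq`: `ns (j+1) y = ns j (emb y) − |Idx|⁻¹ Σ_i (ns j (emb y) − T_{j,y,i}·ns j (x_{y,i})·T_{j,y,i}⁻¹)`, `x_{y,i} = emb y + off i.1`.

WHAT IS PROVED (ns `…Theorems.Prop7CovMeanTowerOnto`; ABSTRACT transporters `T` with `T = 1` at the centre offset — the tree's `holT … (stairWord σ 0) = holT … [] = 1`):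
* §1 geometry: `disp_stairWord` (`disp (stairWord σ n) = n`, via ✓`YMDAG.N18.BoxStokes.disp_apply_eq_netDisp`), `transl_emb_disp_stairWord` (via ✓`YMDAG.N18.TransportOfRecord.transl_emb_off`),
  `off_eq_zero_iff`, `blockSite_eq_emb_iff` (`blockSite y r = emb y ↔ off r = 0`); the empty centre staircase is ✓`Spine.NE7.stairWord_zero`.
* §2 ★★★ `covMeanStep_seed` — for `g : T^{(j+1)} → 𝔸` the CENTRE-SUPPORTED SEED `f x := L^d • (if x = emb (blockOf x) then g (blockOf x) else 0)` returns `g` after one step of the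
  recursion, for EVERY transporter family `T : T^{(j+1)} → Idx → 𝔸ˣ` with `T y i = 1` when `off i.1 = 0` (the `L^d − 1` non-centre block sites carry `f = 0`; the centre term cancels).
* §3 ★★★ `exists_seed_of_covMeanTower` — for `k ≤ m + K` and every target `t : T^{(k)} → 𝔸` there are a seed `N : T^{(0)} → 𝔸` and a full averaging sequence `ns` (`ns 0 = N`, the
  recursion at EVERY level) with `ns k = t`; `exists_avgSeq` (a sequence through the recursion from any seed, by `Nat.rec`).
HONEST SCOPE.  Finite sums and integer labels; no estimate; the CONSUMER (the `QTwS` gauge lift ⇒ `Q_k` onto at `RegPr`) is STEP 2 (not here).  Not a proof of any stub; nothing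
continuum ∕ OS ∕ mass-gap ∕ Clay.

References: T. Bałaban, CMP **99** (1985) 389–434 [Balaban1985BackgroundPropagators] ((3.18)–(3.19) p.393, (3.114)–(3.115) p.418); CMP **98** (1985) 17–51 [Balaban1985Averaging]
((11) p.19, (82) p.30, (97) p.32); CMP **109** (1987) 249–301 [Balaban1987RG1] ((0.1)–(0.3) pp.251–252).
-/

set_option autoImplicit false

noncomputable section

open scoped BigOperators

namespace Summit.QuantumFields.YangMills.Theorems.Prop7CovMeanTowerOnto

open Literature.MathematicalPhysics.QuantumFieldTheory.Balaban1983to89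
open T4Continuum BlockAveraging AveragingRT
open B7Prop1Explicit (disp disp_nil disp_cons e_apply)
open B10Eq27TorusAxialLog (transl transl_apply)
open B7TransferAnalyticMean (meanCLM meanCLM_apply)
open B12B0LoopGeometry267 (emb_eq_blockSite)
open YMDAG.N18.BoxStokes (disp_apply_eq_netDisp)
open YMDAG.N18.TransportOfRecord (transl_emb_off)
open Summit.QuantumFields.BalabanUV.T4Continuum.Spine.NE7 (stairWord_zero)

variable {P : Params} {j : ℕ}

/-! ## §1 Lattice geometry: the block sites of the recursion, the centre offset -/

/-- A staircase word to `n` displaces by `n`. [cite: Balaban1987RG1, (0.3) p.252] -/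
theorem disp_stairWord {d : ℕ} (σ : Equiv.Perm (Fin d)) (n : Fin d → ℤ) : disp (stairWord σ n) = n := by
  funext ν; rw [disp_apply_eq_netDisp, netDisp_stairWord]

/-- The block site reached by the staircase `Γ_{y, i}` of the recursion is `blockSite y i.1`. [cite: Balaban1987RG1, (0.3) p.252] -/
theorem transl_emb_disp_stairWord (y : Site P (j + 1)) (σ : Equiv.Perm (Fin P.d)) (r : Fin P.d → Fin P.L) :
    transl (emb y) (disp (stairWord σ (off r))) = Site.blockSite y r := by
  rw [disp_stairWord, transl_emb_off]

/-- The centre offset: `off r = 0 ↔ r ≡ (L−1)∕2`. [cite: Balaban1987RG1, (0.1) p.252] -/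
theorem off_eq_zero_iff (r : Fin P.d → Fin P.L) : off r = 0 ↔ r = fun _ => ⟨(P.L - 1) / 2, half_lt P⟩ := by
  constructor
  · intro h; funext ν; apply Fin.ext
    have := congrFun h ν
    simp only [off, Pi.zero_apply, sub_eq_zero] at this
    exact_mod_cast this
  · rintro rfl; funext ν; simp [off]

/-- `blockSite y r` is the centre `emb y` iff `off r = 0` (standing range `j + 1 ≤ m + K`). [cite: Balaban1987RG1, (0.1) p.252] -/
theorem blockSite_eq_emb_iff (hj : j + 1 ≤ P.m + P.K) (y : Site P (j + 1)) (r : Fin P.d → Fin P.L) :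
    Site.blockSite y r = emb y ↔ off r = 0 := by
  rw [emb_eq_blockSite, off_eq_zero_iff]
  constructor
  · intro h; exact (blockSite_inj hj h).2
  · rintro rfl; rfl

/-! ## §2 One step: the centre-supported seed returns the target -/

variable {𝔸 : Type*} [NormedRing 𝔸] [NormedAlgebra ℂ 𝔸]

/-- The index set of the symmetric recursion has `L^d · |Perm|²` elements. [folklore] -/
theorem card_idx (P : Params) : Fintype.card (Idx P) = P.L ^ P.d * (Fintype.card (Equiv.Perm (Fin P.d)) * Fintype.card (Equiv.Perm (Fin P.d))) := by
  rw [Fintype.card_prod, Fintype.card_prod, Fintype.card_fun, Fintype.card_fin, Fintype.card_fin]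

/-- Exactly `|Perm|²` indices sit at the centre offset. [folklore] -/
theorem card_idx_centre (P : Params) :
    (Finset.univ.filter fun i : Idx P => off i.1 = 0).card = Fintype.card (Equiv.Perm (Fin P.d)) * Fintype.card (Equiv.Perm (Fin P.d)) := by
  have h : (Finset.univ.filter fun i : Idx P => off i.1 = 0)
      = (Finset.univ.filter fun r : Fin P.d → Fin P.L => off r = 0) ×ˢ (Finset.univ : Finset (Equiv.Perm (Fin P.d) × Equiv.Perm (Fin P.d))) := by
    ext i; simp
  rw [h, Finset.card_product, Finset.card_univ, Fintype.card_prod]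
  have h1 : (Finset.univ.filter fun r : Fin P.d → Fin P.L => off r = 0) = {fun _ => ⟨(P.L - 1) / 2, half_lt P⟩} := by
    ext r; simp [off_eq_zero_iff]
  rw [h1, Finset.card_singleton, one_mul]

/-- ★★★ **ONE STEP OF THE COVARIANT BLOCK Ad-MEAN IS ONTO BY A CENTRE-SUPPORTED SEED**: for `g : T^{(j+1)} → 𝔸` put `f x := L^d • (if x = emb (blockOf x) then g (blockOf x) else 0)`;
then for EVERY transporter family `T` equal to `1` at the centre offset, `f (emb y) − |Idx|⁻¹ Σ_i (f (emb y) − T y i · f (x_{y,i}) · (T y i)⁻¹) = g y`.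
[cite: Balaban1985BackgroundPropagators, (3.18)–(3.19) p.393; Balaban1985Averaging, (11) p.19] -/
theorem covMeanStep_seed (hj : j + 1 ≤ P.m + P.K) (T : Site P (j + 1) → Idx P → 𝔸ˣ) (hT : ∀ y i, off i.1 = 0 → (T y i : 𝔸) = 1)
    (g : Site P (j + 1) → 𝔸) (y : Site P (j + 1)) :
    (fun x : Site P j => ((P.L ^ P.d : ℕ) : ℂ) • (if x = emb (blockOf x) then g (blockOf x) else 0)) (emb y)
      - meanCLM (Idx P) 𝔸 (fun i : Idx P =>
          (fun x : Site P j => ((P.L ^ P.d : ℕ) : ℂ) • (if x = emb (blockOf x) then g (blockOf x) else 0)) (emb y)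
            - (T y i : 𝔸) * (fun x : Site P j => ((P.L ^ P.d : ℕ) : ℂ) • (if x = emb (blockOf x) then g (blockOf x) else 0))
                (transl (emb y) (disp (stairWord i.2.1 (off i.1)))) * ((T y i)⁻¹ : 𝔸ˣ))
      = g y := by
  set c : ℂ := ((P.L ^ P.d : ℕ) : ℂ) with hc
  set p : ℕ := Fintype.card (Equiv.Perm (Fin P.d)) * Fintype.card (Equiv.Perm (Fin P.d)) with hp
  have hcentre : ∀ x : Site P j, x = emb y → (c • (if x = emb (blockOf x) then g (blockOf x) else 0) : 𝔸) = c • g y := by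
    rintro x rfl; rw [Site.blockOf_emb hj, if_pos rfl]
  have hfy : (fun x : Site P j => c • (if x = emb (blockOf x) then g (blockOf x) else 0)) (emb y) = c • g y := hcentre _ rfl
  -- the block sites: centre term `0`, non-centre terms `f (emb y)`
  have hterm : ∀ i : Idx P,
      (fun x : Site P j => c • (if x = emb (blockOf x) then g (blockOf x) else 0)) (emb y)
        - (T y i : 𝔸) * (fun x : Site P j => c • (if x = emb (blockOf x) then g (blockOf x) else 0)) (transl (emb y) (disp (stairWord i.2.1 (off i.1)))) * ((T y i)⁻¹ : 𝔸ˣ)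
      = if off i.1 = 0 then 0 else c • g y := by
    intro i
    simp only [hfy]
    rw [transl_emb_disp_stairWord]
    by_cases h0 : off i.1 = 0
    · have hx : Site.blockSite y i.1 = emb y := (blockSite_eq_emb_iff hj y i.1).2 h0
      have hu : T y i = 1 := Units.val_eq_one.mp (hT y i h0)
      rw [if_pos h0, hx, Site.blockOf_emb hj, if_pos rfl, hu, inv_one, Units.val_one, one_mul, mul_one, sub_self]
    · have hx : ¬ Site.blockSite y i.1 = emb (blockOf (Site.blockSite y i.1)) := by
        rw [Site.blockOf_blockSite hj]; exact fun h => h0 ((blockSite_eq_emb_iff hj y i.1).1 h)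
      rw [if_neg h0, if_neg hx, smul_zero, mul_zero, zero_mul, sub_zero]
  have hsum : ∑ i : Idx P, (if off i.1 = 0 then (0 : 𝔸) else c • g y) = ((Fintype.card (Idx P) - p : ℕ) : ℂ) • (c • g y) := by
    rw [Finset.sum_ite, Finset.sum_const_zero, zero_add, Finset.sum_const, ← Nat.cast_smul_eq_nsmul ℂ]
    congr 2
    have htot := Finset.card_filter_add_card_filter_not (s := (Finset.univ : Finset (Idx P))) (fun i : Idx P => off i.1 = 0)
    rw [card_idx_centre, Finset.card_univ] at htot
    omega
  have hcard : (Fintype.card (Idx P) : ℂ) = c * p := by rw [card_idx, hc, hp]; push_cast; ring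
  have hc0 : c ≠ 0 := by rw [hc]; exact_mod_cast (pow_pos P.L_pos P.d).ne'
  have hp0 : (p : ℂ) ≠ 0 := by rw [hp]; exact_mod_cast (Nat.mul_pos Fintype.card_pos Fintype.card_pos).ne'
  have hle : p ≤ Fintype.card (Idx P) := by rw [card_idx, ← hp]; exact Nat.le_mul_of_pos_left _ (pow_pos P.L_pos P.d)
  rw [meanCLM_apply, Finset.sum_congr rfl fun i _ => hterm i, hsum, hfy, smul_smul, smul_smul, ← sub_smul, Nat.cast_sub hle, hcard]
  have : c - (c * ↑p)⁻¹ * (c * ↑p - ↑p) * c = 1 := by field_simp; ring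
  rw [this, one_smul]

/-! ## §3 The tower: a full averaging sequence from a seed, and the seed hitting any target at level `k` -/

/-- A full averaging sequence through the recursion from any seed (by `Nat.rec`). [cite: Balaban1985Averaging, (11) p.19, (97) p.32] -/
theorem exists_avgSeq (T : (j : ℕ) → Site P (j + 1) → Idx P → 𝔸ˣ) (N : Site P 0 → 𝔸) :
    ∃ ns : (j : ℕ) → Site P j → 𝔸, ns 0 = N ∧ ∀ (j : ℕ) (y : Site P (j + 1)), ns (j + 1) y = ns j (emb y)
      - meanCLM (Idx P) 𝔸 (fun i : Idx P => ns j (emb y) - (T j y i : 𝔸) * ns j (transl (emb y) (disp (stairWord i.2.1 (off i.1)))) * ((T j y i)⁻¹ : 𝔸ˣ)) := by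
  refine ⟨fun j => Nat.rec (motive := fun j => Site P j → 𝔸) N (fun j f => fun y => f (emb y)
      - meanCLM (Idx P) 𝔸 (fun i : Idx P => f (emb y) - (T j y i : 𝔸) * f (transl (emb y) (disp (stairWord i.2.1 (off i.1)))) * ((T j y i)⁻¹ : 𝔸ˣ))) j, rfl, fun j y => rfl⟩

/-- ★★★ **THE `k`-FOLD COVARIANT BLOCK Ad-MEAN IS ONTO**: for `k ≤ m + K`, every transporter tower `T` equal to `1` at the centre offsets and every target `t : T^{(k)} → 𝔸`, there are a seed
`N` and a full averaging sequence `ns` from `N` with `ns k = t` (induction on `k` with §2's seed at each level). [cite: Balaban1985BackgroundPropagators, (3.19) p.393] -/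
theorem exists_seed_of_covMeanTower (T : (j : ℕ) → Site P (j + 1) → Idx P → 𝔸ˣ) (hT : ∀ j y i, off i.1 = 0 → (T j y i : 𝔸) = 1) :
    ∀ (k : ℕ), k ≤ P.m + P.K → ∀ t : Site P k → 𝔸, ∃ (N : Site P 0 → 𝔸) (ns : (j : ℕ) → Site P j → 𝔸), ns 0 = N ∧
      (∀ (j : ℕ) (y : Site P (j + 1)), ns (j + 1) y = ns j (emb y)
        - meanCLM (Idx P) 𝔸 (fun i : Idx P => ns j (emb y) - (T j y i : 𝔸) * ns j (transl (emb y) (disp (stairWord i.2.1 (off i.1)))) * ((T j y i)⁻¹ : 𝔸ˣ))) ∧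
      ns k = t
  | 0, _, t => by
    obtain ⟨ns, h0, hs⟩ := exists_avgSeq T t
    exact ⟨t, ns, h0, hs, h0⟩
  | k + 1, hk, t => by
    obtain ⟨N, ns, h0, hs, hk'⟩ := exists_seed_of_covMeanTower T hT k (by omega)
      (fun x : Site P k => ((P.L ^ P.d : ℕ) : ℂ) • (if x = emb (blockOf x) then t (blockOf x) else 0))
    refine ⟨N, ns, h0, hs, funext fun y => ?_⟩
    rw [hs k y, hk']
    exact covMeanStep_seed hk (T k) (hT k) t y

end Summit.QuantumFields.YangMills.Theorems.Prop7CovMeanTowerOnto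

end
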